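import Literature.AnabelianGeometry.EtaleTheta.SettingProdDiscrete
import Literature.AnabelianGeometry.EtaleTheta.SettingModel
import Mathlib.Topology.Instances.ZMod
import HarnessLib

/-!
# [EtTh] §1: the vacuity guard `IsEtThOrigin` ("`Δ_X` is a profinite free group on 2 generators") is NOT
# derivable from the root interface `ThetaSetting p` — kernel independence certificate (FACT-LIST F-2498)

Mochizuki, *The étale theta function …*, Publ. RIMS **45** (2009) [EtTh], §1, PRIMS PDF p. 12: "Since `Δ_X` is a
profinite free group on 2 generators …" [cite: MochizukiEtTh2009, §1 p.12].

PROOF-ONLY file (abc-iut cell, block F fact-proving wave, seat abc-iut-f-132; FACT-LIST row F-2498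
`ThetaSetting.IsEtThOrigin`, the guard structure of `Setting.lean`, abc-iut-L2-t1).  The row is VOCABULARY (a
hypothesis structure consumed BY NAME in the shape `∀ D, D.IsEtThOrigin → …`); its instance form is PROVED in the
tree at abc-iut-L2-t1's root model (`ThetaSetting.model_isEtThOrigin`, `SettingModel.lean`; `model₂_isEtThOrigin`),
and `isEtThOrigin_iff_free` (`Discharge/Sec1OriginOfFree.lean`) reduces it to its printed first field.  THIS FILE
decides the remaining question — is the guard a CONSEQUENCE of the root interface? — in the negative:

* `IsFreeProfiniteOnTwo.exists_pair_forall_mem_closure` — a group free profinite on two generators `a, b` (the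
  tree's `IsFreeProfiniteOnTwo`: universal property with UNIQUENESS against finite discrete groups) has all its
  continuous finite quotients generated by the images of `a, b` (uniqueness applied to the corestriction onto
  `⟨f a, f b⟩`);
* `ElemTwo.closure_pair_ne_top` — the elementary abelian group `(ℤ/2)² × ℤ/2` of order `8` is not generated by
  two elements (`⟨u, v⟩ ⊆ {1, u, v, uv}`);
* `ThetaSetting.not_isFreeProfiniteOnTwo_deltaHat_prod` — hence `Δ_X × ℤ/2` is NOT free profinite on two
  generators whenever `Δ_X` is (it surjects continuously onto `(ℤ/2)² × ℤ/2`);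
* **`ThetaSetting.prodDiscrete_not_isEtThOrigin`** — for EVERY theta setting `D` satisfying the guard, the product
  setting `D × ℤ/2` (`ThetaSetting.prodDiscrete`, `SettingProdDiscrete.lean`: again an inhabitant of the root
  interface, `Δ_X ↦ Δ_X × ℤ/2`) VIOLATES it; with the root model: **`ThetaSetting.not_forall_isEtThOrigin`**,
  `exists_not_isEtThOrigin`, `isEtThOrigin_independent` (both truth values inhabited), `not_forall_isEtThOrigin_univ`.
So `IsEtThOrigin` is a genuinely needed, non-idle hypothesis of the cell's `∀ D, D.IsEtThOrigin → …` statements —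
the root interface records `Π^tp_X ↠ Z`, the theta quotients and the coverings, but nothing that forces `Δ_X` free.
FACT-LIST reading: VOCAB; instance PROVED (model); universal closure REFUTED here.

HONEST FRAMING: a statement about OUR typed interface and its synthetic inhabitants; nothing of [EtTh] is
asserted or disputed; no side taken on [IUTchIII] Cor. 3.12.
-/

noncomputable section

namespace Literature.AnabelianGeometry.EtaleTheta

open Literature.AnabelianGeometry.SemiGraphs

/-! ### Free profinite groups on two generators: finite quotients are 2-generated -/

/-- **A free profinite group on two generators `a, b` has 2-generated continuous finite quotients**: for every
continuous `f : P → Q` to a finite discrete group, `f(P) ⊆ ⟨f a, f b⟩` — the UNIQUENESS clause of the universal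
property, applied to `f` and to the corestriction of the induced map onto `⟨f a, f b⟩`.
[cite: MochizukiEtTh2009, §1 p.12] -/
theorem IsFreeProfiniteOnTwo.exists_pair_forall_mem_closure {P : Type*} [Group P] [TopologicalSpace P]
    (h : IsFreeProfiniteOnTwo P) :
    ∃ a b : P, ∀ (Q : Type) [Group Q] [Finite Q] [TopologicalSpace Q] [DiscreteTopology Q] (f : P →ₜ* Q)
      (x : P), f x ∈ Subgroup.closure ({f a, f b} : Set Q) := by
  obtain ⟨-, -, -, a, b, huniv⟩ := h
  refine ⟨a, b, fun Q _ _ _ _ f x => ?_⟩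
  set Q' : Subgroup Q := Subgroup.closure ({f a, f b} : Set Q) with hQ'
  have ha : f a ∈ Q' := Subgroup.subset_closure (Set.mem_insert _ _)
  have hb : f b ∈ Q' := Subgroup.subset_closure (Set.mem_insert_of_mem _ rfl)
  obtain ⟨g, ⟨hga, hgb⟩, -⟩ := huniv (↥Q') ⟨f a, ha⟩ ⟨f b, hb⟩
  let i : ↥Q' →ₜ* Q := ⟨Q'.subtype, continuous_subtype_val⟩
  have hia : (i.comp g) a = f a := by
    show ((g a : ↥Q') : Q) = f a
    rw [hga]
  have hib : (i.comp g) b = f b := by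
    show ((g b : ↥Q') : Q) = f b
    rw [hgb]
  have hfi : i.comp g = f := (huniv Q (f a) (f b)).unique ⟨hia, hib⟩ ⟨rfl, rfl⟩
  have hx : f x = ((g x : ↥Q') : Q) := by
    rw [← hfi]
    rfl
  rw [hx]
  exact (g x).2

/-! ### The elementary abelian group `(ℤ/2)² × ℤ/2` is not 2-generated -/

namespace ElemTwo

set_option synthInstance.maxSize 2048 in
-- (the nested decidability instance for four quantifiers over the 8-element group exceeds the default size)
/-- In `(ℤ/2)² × ℤ/2` the set `{1, u, v, uv}` is closed under multiplication. [folklore] -/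
private theorem four_mul (u v w₁ w₂ : (Multiplicative (ZMod 2 × ZMod 2) × Multiplicative (ZMod 2))) :
    (w₁ = 1 ∨ w₁ = u ∨ w₁ = v ∨ w₁ = u * v) → (w₂ = 1 ∨ w₂ = u ∨ w₂ = v ∨ w₂ = u * v) →
      (w₁ * w₂ = 1 ∨ w₁ * w₂ = u ∨ w₁ * w₂ = v ∨ w₁ * w₂ = u * v) := by
  revert u v w₁ w₂
  decide

set_option synthInstance.maxSize 2048 in
-- (same)
/-- In `(ℤ/2)² × ℤ/2`, no two elements `u, v` exhaust the group together with `1, uv`. [folklore] -/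
private theorem exists_not_four (u v : (Multiplicative (ZMod 2 × ZMod 2) × Multiplicative (ZMod 2))) : ∃ w : (Multiplicative (ZMod 2 × ZMod 2) × Multiplicative (ZMod 2)), w ≠ u ∧ w ≠ v ∧ w ≠ u * v ∧ w ≠ 1 := by
  revert u v
  decide

/-- Every element of `(ℤ/2)² × ℤ/2` is its own inverse. [folklore] -/
private theorem inv_eq_self (u : (Multiplicative (ZMod 2 × ZMod 2) × Multiplicative (ZMod 2))) : u⁻¹ = u := by
  revert u
  decide

/-- The subgroup generated by `u, v` in `(ℤ/2)² × ℤ/2` is contained in `{1, u, v, uv}`. [folklore] -/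
private theorem mem_four_of_mem_closure (u v : (Multiplicative (ZMod 2 × ZMod 2) × Multiplicative (ZMod 2))) {w : (Multiplicative (ZMod 2 × ZMod 2) × Multiplicative (ZMod 2))} (hw : w ∈ Subgroup.closure ({u, v} : Set (Multiplicative (ZMod 2 × ZMod 2) × Multiplicative (ZMod 2)))) :
    w = 1 ∨ w = u ∨ w = v ∨ w = u * v := by
  induction hw using Subgroup.closure_induction with
  | mem x hx =>
    rcases hx with rfl | hx
    · exact Or.inr (Or.inl rfl)
    · rw [Set.mem_singleton_iff] at hx
      exact Or.inr (Or.inr (Or.inl hx))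
  | one => exact Or.inl rfl
  | mul x y _ _ hx hy => exact four_mul u v x y hx hy
  | inv x _ hx => rw [inv_eq_self]; exact hx

/-- **`(ℤ/2)² × ℤ/2` is not generated by two elements.** [folklore] -/
private theorem closure_pair_ne_top (u v : Multiplicative (ZMod 2 × ZMod 2) × Multiplicative (ZMod 2)) :
    Subgroup.closure ({u, v} : Set (Multiplicative (ZMod 2 × ZMod 2) × Multiplicative (ZMod 2))) ≠ ⊤ := by
  intro h
  obtain ⟨w, hu, hv, huv, h1⟩ := exists_not_four u v
  rcases mem_four_of_mem_closure u v (h ▸ Subgroup.mem_top w) with h | h | h | h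
  · exact h1 h
  · exact hu h
  · exact hv h
  · exact huv h

/-- Every element of `ℤ/2 × ℤ/2` is one of `1, e₁, e₂, e₁e₂`. [folklore] -/
private theorem cases_two (q : Multiplicative (ZMod 2 × ZMod 2)) :
    q = 1 ∨ q = Multiplicative.ofAdd (1, 0) ∨ q = Multiplicative.ofAdd (0, 1) ∨
      q = Multiplicative.ofAdd (1, 0) * Multiplicative.ofAdd (0, 1) := by
  revert q
  decide

end ElemTwo

/-! ### `Δ_X × ℤ/2` is not free profinite on two generators -/

namespace ThetaSetting

variable {p : ℕ} [Fact p.Prime] (D : ThetaSetting p)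

/-- **If `Δ_X` is free profinite on two generators, then `Δ_X × ℤ/2` is not**: `Δ_X` surjects continuously onto
`(ℤ/2)²` (universal property), so `Δ_X × ℤ/2` surjects continuously onto `(ℤ/2)² × ℤ/2`, which is not
2-generated — while the continuous finite quotients of a free profinite group on two generators are.
[cite: MochizukiEtTh2009, §1 p.12] -/
theorem not_isFreeProfiniteOnTwo_deltaHat_prod (hfree : IsFreeProfiniteOnTwo D.DeltaHat) :
    ¬ IsFreeProfiniteOnTwo ↥(D.DeltaHat.prod (⊤ : Subgroup (Multiplicative (ZMod 2)))) := by
  intro h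
  obtain ⟨-, -, -, a₀, b₀, huniv⟩ := hfree
  obtain ⟨f₀, ⟨hfa, hfb⟩, -⟩ :=
    huniv (Multiplicative (ZMod 2 × ZMod 2)) (Multiplicative.ofAdd (1, 0)) (Multiplicative.ofAdd (0, 1))
  -- the first projection `Δ_X × ℤ/2 → Δ_X` and the continuous homomorphism `g : Δ_X × ℤ/2 → (ℤ/2)² × ℤ/2`
  let S : Subgroup (D.PiHat × Multiplicative (ZMod 2)) := D.DeltaHat.prod ⊤
  let π₁ : ↥S →* ↥D.DeltaHat :=
    ((MonoidHom.fst D.PiHat (Multiplicative (ZMod 2))).restrict S).codRestrict D.DeltaHat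
      fun x => (Subgroup.mem_prod.mp x.2).1
  have hπ₁ : Continuous π₁ :=
    (continuous_fst.comp continuous_subtype_val).subtype_mk _
  let gm : ↥S →* Multiplicative (ZMod 2 × ZMod 2) × Multiplicative (ZMod 2) :=
    (f₀.toMonoidHom.comp π₁).prod ((MonoidHom.snd D.PiHat (Multiplicative (ZMod 2))).restrict S)
  have hgm : Continuous gm :=
    ((map_continuous f₀).comp hπ₁).prodMk (continuous_snd.comp continuous_subtype_val)
  let g : ↥S →ₜ* Multiplicative (ZMod 2 × ZMod 2) × Multiplicative (ZMod 2) := ⟨gm, hgm⟩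
  have hg : ∀ (d : ↥D.DeltaHat) (c : Multiplicative (ZMod 2)),
      g ⟨((d : D.PiHat), c), Subgroup.mem_prod.mpr ⟨d.2, Subgroup.mem_top c⟩⟩ = (f₀ d, c) := fun _ _ => rfl
  -- `g` is onto
  have hsurj : Function.Surjective g := by
    rintro ⟨q, c⟩
    rcases ElemTwo.cases_two q with rfl | rfl | rfl | rfl
    · exact ⟨⟨(((1 : ↥D.DeltaHat) : D.PiHat), c), _⟩, by rw [hg, map_one]⟩
    · exact ⟨⟨(((a₀ : ↥D.DeltaHat) : D.PiHat), c), _⟩, by rw [hg, hfa]⟩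
    · exact ⟨⟨(((b₀ : ↥D.DeltaHat) : D.PiHat), c), _⟩, by rw [hg, hfb]⟩
    · exact ⟨⟨(((a₀ * b₀ : ↥D.DeltaHat) : D.PiHat), c), _⟩, by rw [hg, map_mul, hfa, hfb]⟩
  -- but the image of a free profinite group on two generators is 2-generated
  obtain ⟨a, b, hab⟩ := h.exists_pair_forall_mem_closure
  refine ElemTwo.closure_pair_ne_top (g a) (g b) (top_le_iff.mp fun e _ => ?_)
  obtain ⟨x, rfl⟩ := hsurj e
  exact hab _ g x

/-- **For every theta setting satisfying the guard, the product setting `D × ℤ/2` violates it.**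
[cite: MochizukiEtTh2009, §1 p.12] -/
theorem prodDiscrete_not_isEtThOrigin (hD : D.IsEtThOrigin) :
    ¬ (D.prodDiscrete (Multiplicative (ZMod 2))).IsEtThOrigin := by
  intro h
  have h1 := h.deltaHat_free
  rw [deltaHat_prodDiscrete] at h1
  exact D.not_isFreeProfiniteOnTwo_deltaHat_prod hD.deltaHat_free h1

variable (p) in
/-- **The guard is not a consequence of the root interface: `¬ ∀ D : ThetaSetting p, D.IsEtThOrigin`** —
witnessed by the product of abc-iut-L2-t1's root model (which satisfies the guard) with `ℤ/2`.
[cite: MochizukiEtTh2009, §1 p.12] -/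
theorem not_forall_isEtThOrigin : ¬ ∀ D : ThetaSetting p, D.IsEtThOrigin := fun h =>
  (ThetaSetting.model p).prodDiscrete_not_isEtThOrigin (ThetaSetting.model_isEtThOrigin p) (h _)

variable (p) in
/-- An inhabitant of the root interface VIOLATING the guard exists. [cite: MochizukiEtTh2009, §1 p.12] -/
theorem exists_not_isEtThOrigin : ∃ D : ThetaSetting p, ¬ D.IsEtThOrigin :=
  ⟨(ThetaSetting.model p).prodDiscrete (Multiplicative (ZMod 2)),
    (ThetaSetting.model p).prodDiscrete_not_isEtThOrigin (ThetaSetting.model_isEtThOrigin p)⟩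

variable (p) in
/-- **Independence of the guard from the root**: both truth values of `IsEtThOrigin` are realised by
inhabitants of `ThetaSetting p` (abc-iut-L2-t1's model; its product with `ℤ/2`). [cite: MochizukiEtTh2009, §1 p.12] -/
theorem isEtThOrigin_independent :
    (∃ D : ThetaSetting p, D.IsEtThOrigin) ∧ ∃ D : ThetaSetting p, ¬ D.IsEtThOrigin :=
  ⟨ThetaSetting.exists_isEtThOrigin p, exists_not_isEtThOrigin p⟩

/-- The universal closure over ALL binders of the row (`p`, `D`) is false. [cite: MochizukiEtTh2009, §1 p.12] -/
theorem not_forall_isEtThOrigin_univ : ¬ ∀ (p : ℕ) (_ : Fact p.Prime) (D : ThetaSetting p), D.IsEtThOrigin :=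
  fun h => not_forall_isEtThOrigin 2 (h 2 ⟨Nat.prime_two⟩)

end ThetaSetting

end Literature.AnabelianGeometry.EtaleTheta

end
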